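import Summits.SmoothPoincare4.SmoothPoincare4.Theorems.ConvexBisectionAcyclicBisectionExistsSeamTwistSignIsotopy
import Summits.SmoothPoincare4.SmoothPoincare4.Theorems.ConvexBisectionAcyclicBisectionExistsSeamTwistSignBoundaryDeriv
import Summits.SmoothPoincare4.SmoothPoincare4.Theorems.ConvexBisectionAcyclicBisectionExistsSeamStraightenFlow
import HarnessLib

/-!
# Seam transport, ST4 (4b, the universal straightening): page determinants of all straightenings of the
# seam map at a flat point have the same sign
(wave 5, brick X3-5a of sub-node ST4 `node_ST4_twistSign` of node T3c-2 `node_seam_transport` of stub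
`stub_T3_dualPresentation` (T3), line `modp-braid-orbits`, crux `ConvexBisection.AcyclicBisectionExists`,
item stmt-SmoothPoincare4-10508; registered sub-goal `helper_pageDet_seam_compare`)

Let `F = seamB D bX Ψ : ∂ Base g ∖ cores → ∂ Base g` be the seam map of a fibred model (page clause:
`w (F y) = r(y) w y`, `r > 0`; `…SeamTwistSignLift.lean`) and let `y` be a FLAT page point off the cores
(`y ∈ page g c`).  The image `F y` lies in the extended page of direction `c`, possibly in the bent part.
ST4 compares the knot's flattening `R` (ANY fibred ambient isotopy with `R_1 (F y) ∈ page g c`) with the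
UNIVERSAL straightening `S = strIso g m` of ST2 (`node_ST2_straightening` = `helper_strFlow_page`,
chosen once and for all by `Classical.choose`, §1): by the chain rule on the boundary 3-manifold
(`bdDeriv_comp`) and `R_1 = (R_1 ∘ S_{-1}) ∘ S_1`,
`bdDeriv (R_1 ∘ F) y = ambDeriv (R_1 ∘ S_{-1}) (S_1 (F y)) ∘ bdDeriv (S_1 ∘ F) y`, and the middle factor
has POSITIVE page determinant (`helper_pageDet_straighten_pos`); hence (`pageDet_seam_compare`,
registered as `helper_pageDet_seam_compare`)
`pageDet (bdDeriv (R_1 ∘ F) y) = κ · pageDet (bdDeriv (S_1 ∘ F) y)` with `κ > 0`, for every `m` below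
the `‖w‖`-values of the orbit `R_t (F y)`.  In particular two universal straightenings `S^m`, `S^{m'}`
give the same sign (`pageDet_seam_compare_str`), and that sign is non-zero (`pageDet_seam_str_ne_zero`).

Everything is proved; no named facts, no `sorry`.  References: R. İ. Baykur, AGT 6 (2006), Thm. 5.1
(proof, p. 13) [Baykur2006]; J. B. Etnyre, T. Fuller, IMRN 2006, Thm. 1 (proof, p. 8) [EtnyreFuller2006].
-/

noncomputable section

set_option linter.dupNamespace false

open scoped Manifold ContDiff Topology ComplexConjugate

namespace Summit.SmoothPoincare4.SmoothPoincare4.Theorems.AcyclicBisectionExists.ModpBraidOrbits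

open Set Function Filter Complex
open Literature.Topology.FourManifolds Literature.Topology.FourManifolds.HandleAttachingMap
  Literature.Topology.FourManifolds.BoundaryManifold Literature.Topology.FourManifolds.LefschetzBase
  Literature.Geometry.Symplectic

variable {g : ℕ}

/-! ## §1 The universal straightening isotopies `S^m` of ST2 -/

/-- **The straightening isotopy of ST2 at margin `m`** (`helper_strFlow_page`, chosen). [cite: Baykur2006, Thm. 5.1 (proof, p. 13)] -/
def strIso (g : ℕ) (m : ℝ) (hm : 0 < m) : AmbientIsotopy (𝓡∂ 4) (Base g) :=
  Classical.choose (helper_strFlow_page g m hm)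

/-- The ambient flow of the straightening isotopy (chosen). [cite: Baykur2006, Thm. 5.1 (proof, p. 13)] -/
def strFlow (g : ℕ) (m : ℝ) (hm : 0 < m) : ℝ × EuclideanSpace ℝ (Fin 4) → EuclideanSpace ℝ (Fin 4) :=
  Classical.choose (Classical.choose_spec (helper_strFlow_page g m hm))

/-- The specification of the straightening data (all clauses of `helper_strFlow_page`). [cite: Baykur2006, Thm. 5.1 (proof, p. 13)] -/
theorem strFlow_spec (g : ℕ) (m : ℝ) (hm : 0 < m) :
    ContDiff ℝ ∞ (strFlow g m hm) ∧ (∀ x, strFlow g m hm (0, x) = x) ∧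
    (∀ t s x, strFlow g m hm (t, strFlow g m hm (s, x)) = strFlow g m hm (t + s, x)) ∧
    (∀ (t : ℝ) (x : Base g), ((strIso g m hm).toFun t x).1 = strFlow g m hm (t, x.1)) ∧
    (∀ t x, rho g (strFlow g m hm (t, x)) = rho g x) ∧
    (∀ t x, ∃ r : ℝ, 0 < r ∧ w g (strFlow g m hm (t, x)) = (r : ℂ) * w g x) ∧
    (∀ t x, 0 ≤ t → ‖w g x‖ ≤ ‖w g (strFlow g m hm (t, x))‖) ∧
    (∀ t x, 0 ≤ t → ‖cx (strFlow g m hm (t, x))‖ ^ 2 ≤ ‖cx x‖ ^ 2) ∧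
    (∀ x, w g x = 0 → ∀ t, strFlow g m hm (t, x) = x) ∧
    (∀ x, ‖cx x‖ ^ 2 ≤ 3 → ∀ t, strFlow g m hm (t, x) = x) ∧
    (∀ x, rho g x ≤ 3 / 10 → m ≤ ‖w g x‖ → ‖cx (strFlow g m hm (1, x))‖ ^ 2 < 4) ∧
    (∀ (t : ℝ) (x : Base g) (c : ℂ), 0 ≤ t → x ∈ page g c → (strIso g m hm).toFun t x ∈ page g c) ∧
    (∀ (x : Base g) (c : ℂ), ‖c‖ = 1 → rho g x.1 = 1 / 4 → m ≤ ‖w g x.1‖ →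
      (∃ r : ℝ, 0 < r ∧ w g x.1 = (r : ℂ) * c) → (strIso g m hm).toFun 1 x ∈ page g c) :=
  Classical.choose_spec (Classical.choose_spec (helper_strFlow_page g m hm))

section StrAPI

variable (m : ℝ) (hm : 0 < m)

/-- The flow is smooth. [folklore] -/
theorem str_contDiff : ContDiff ℝ ∞ (strFlow g m hm) := (strFlow_spec g m hm).1

/-- The flow starts at the identity. [folklore] -/
theorem str_zero (x : EuclideanSpace ℝ (Fin 4)) : strFlow g m hm (0, x) = x := (strFlow_spec g m hm).2.1 x

/-- The flow property. [folklore] -/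
theorem str_add (t s : ℝ) (x : EuclideanSpace ℝ (Fin 4)) :
    strFlow g m hm (t, strFlow g m hm (s, x)) = strFlow g m hm (t + s, x) := (strFlow_spec g m hm).2.2.1 t s x

/-- The isotopy is the restriction of the flow. [folklore] -/
theorem str_coe (t : ℝ) (x : Base g) : ((strIso g m hm).toFun t x).1 = strFlow g m hm (t, x.1) :=
  (strFlow_spec g m hm).2.2.2.1 t x

/-- The flow preserves `rho`. [folklore] -/
theorem str_rho (t : ℝ) (x : EuclideanSpace ℝ (Fin 4)) : rho g (strFlow g m hm (t, x)) = rho g x :=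
  (strFlow_spec g m hm).2.2.2.2.1 t x

/-- The flow preserves the direction of `w`. [folklore] -/
theorem str_dir (t : ℝ) (x : EuclideanSpace ℝ (Fin 4)) :
    ∃ r : ℝ, 0 < r ∧ w g (strFlow g m hm (t, x)) = (r : ℂ) * w g x := (strFlow_spec g m hm).2.2.2.2.2.1 t x

/-- `‖w‖` does not decrease forwards. [folklore] -/
theorem str_norm_w_mono (t : ℝ) (x : EuclideanSpace ℝ (Fin 4)) (ht : 0 ≤ t) :
    ‖w g x‖ ≤ ‖w g (strFlow g m hm (t, x))‖ := (strFlow_spec g m hm).2.2.2.2.2.2.1 t x ht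

/-- Flat pages are forward invariant. [folklore] -/
theorem str_page_fwd (t : ℝ) (x : Base g) (c : ℂ) (ht : 0 ≤ t) (hx : x ∈ page g c) :
    (strIso g m hm).toFun t x ∈ page g c := (strFlow_spec g m hm).2.2.2.2.2.2.2.2.2.2.2.1 t x c ht hx

/-- **Flattening**: a point of the extended page of direction `c` with `‖w‖ ≥ m` is moved into `page g c`
at time `1`. [cite: Baykur2006, Thm. 5.1 (proof, p. 13)] -/
theorem str_flat (x : Base g) (c : ℂ) (hc : ‖c‖ = 1) (hρ : rho g x.1 = 1 / 4) (hmw : m ≤ ‖w g x.1‖)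
    (hdir : ∃ r : ℝ, 0 < r ∧ w g x.1 = (r : ℂ) * c) : (strIso g m hm).toFun 1 x ∈ page g c :=
  (strFlow_spec g m hm).2.2.2.2.2.2.2.2.2.2.2.2 x c hc hρ hmw hdir

/-- The isotopy preserves `rho` on the base. [folklore] -/
theorem str_rho_base (t : ℝ) (x : Base g) : rho g ((strIso g m hm).toFun t x).1 = rho g x.1 := by
  rw [str_coe, str_rho]

/-- The isotopy preserves the direction of `w` on the base. [folklore] -/
theorem str_dir_base (t : ℝ) (x : Base g) :
    ∃ r : ℝ, 0 < r ∧ w g ((strIso g m hm).toFun t x).1 = (r : ℂ) * w g x.1 := by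
  rw [str_coe]; exact str_dir m hm t x.1

/-- `S_{-1} ∘ S_1 = id` on the base. [folklore] -/
theorem str_left_inv (x : Base g) : (strIso g m hm).toFun (-1) ((strIso g m hm).toFun 1 x) = x :=
  straighten_left_inv (strIso g m hm) (strFlow g m hm) (str_zero m hm) (str_add m hm) (str_coe m hm) x

end StrAPI

/-! ## §2 Comparison of the knot's flattening with the universal straightening -/

section Compare

variable {ι : Type} [Finite ι] {h : ι → HandleAttachingMap 3 2 (Base g)}
  {X : Type} [TopologicalSpace X] [ChartedSpace (EuclideanHalfSpace 4) X] [IsManifold (𝓡∂ 4) ∞ X]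
  (D : MultiAttachmentData h (𝓡∂ 4) X) (bX : BoundaryData (𝓡∂ 4) X (𝓡 3)) [Nonempty bX.carrier]
  (Ψ : bX.carrier ≃ₘ⟮𝓡 3, 𝓡 3⟯ (bBase g).carrier)
  (hpage : ∀ (y : bX.carrier) (a : ↥(coresComplement h)), bX.incl y = D.jA a →
    ∃ c : ℝ, 0 < c ∧ w g ((bBase g).incl (Ψ y)).1 = (c : ℂ) * w g (a : Base g).1)

/-- The image of a flat page point under the seam map lies in the extended page of the same direction:
`w (seamB y) = r · c`, `r > 0`. [folklore] -/
theorem w_seamB_dir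
    (hpage : ∀ (y : bX.carrier) (a : ↥(coresComplement h)), bX.incl y = D.jA a →
      ∃ c : ℝ, 0 < c ∧ w g ((bBase g).incl (Ψ y)).1 = (c : ℂ) * w g (a : Base g).1)
    {y : (bBase g).carrier} (hy : (y.1 : Base g) ∈ coresComplement h) {c : ℂ} (hyc : y.1 ∈ page g c) :
    ∃ r : ℝ, 0 < r ∧ w g (seamB D bX Ψ y).1 = (r : ℂ) * c := by
  obtain ⟨r, hr, hrw⟩ := w_seamB D bX Ψ hpage hy
  refine ⟨r / 2, by positivity, ?_⟩
  rw [hrw, hyc.2]; push_cast; ring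

include hpage in
/-- **The straightened seam map `S_1 ∘ seamB` is flat-to-flat at `y`** when `m ≤ ‖w (seamB y)‖`. [folklore] -/
theorem str_seamB_mem_page {m : ℝ} (hm : 0 < m) {y : (bBase g).carrier}
    (hy : (y.1 : Base g) ∈ coresComplement h) {c : ℂ} (hc : ‖c‖ = 1) (hyc : y.1 ∈ page g c)
    (hmw : m ≤ ‖w g (seamB D bX Ψ y).1‖) :
    (strIso g m hm).toFun 1 (seamB D bX Ψ y) ∈ page g c :=
  str_flat m hm _ c hc (rho_seamB D bX Ψ y) hmw (w_seamB_dir D bX Ψ hpage hy hyc)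

include hpage in
/-- **The boundary ambient differential of a fibred straightening of the seam map maps the page line into
the page line** (flat-to-flat at `y`). [cite: EtnyreFuller2006, Thm. 1 (proof, p. 8)] -/
theorem bdDeriv_comp_seamB_line {f : Base g → Base g} (hf : ContMDiff (𝓡∂ 4) (𝓡∂ 4) ∞ f)
    (hfρ : ∀ x : Base g, rho g (f x).1 = rho g x.1)
    (hfdir : ∀ x : Base g, ∃ r : ℝ, 0 < r ∧ w g (f x).1 = (r : ℂ) * w g x.1)
    {y : (bBase g).carrier} (hy : (y.1 : Base g) ∈ coresComplement h) {c : ℂ} (hc : ‖c‖ = 1)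
    (hyc : y.1 ∈ page g c) (hfy : f (seamB D bX Ψ y) ∈ page g c) (X : EuclideanSpace ℝ (Fin 4))
    (hX : dPhiX g y.1.1 * cx X + dPhiY y.1.1 * cy X = 0) :
    dPhiX g ((f ∘ seamB D bX Ψ) y).1 * cx (bdDeriv g (f ∘ seamB D bX Ψ) y X) +
      dPhiY ((f ∘ seamB D bX Ψ) y).1 * cy (bdDeriv g (f ∘ seamB D bX Ψ) y X) = 0 := by
  have hG : MDifferentiableAt (𝓡 3) (𝓡∂ 4) (f ∘ seamB D bX Ψ) y :=
    (hf.mdifferentiableAt (by simp)).comp y ((contMDiffAt_seamB D bX Ψ hy).mdifferentiableAt (by simp))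
  have hbd : ∀ y', rho g ((f ∘ seamB D bX Ψ) y').1 = 1 / 4 := fun y' => by
    rw [Function.comp_apply, hfρ, rho_seamB]
  obtain ⟨hflat, hw⟩ := flat_of_mem_page hc hyc
  exact (helper_bdDeriv_fibred g (f ∘ seamB D bX Ψ) y hG hbd (eventually_w_comp_seamB D bX Ψ hfdir hpage hy)
    hflat hfy.1 hw).2.2 X hX

include hpage in
/-- **Comparison of the knot's flattening with a universal straightening.**  Let `R` be a fibred ambient
isotopy with `R_1 (seamB y) ∈ page g c` for the flat page point `y ∈ page g c` off the cores, and let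
`0 < m ≤ ‖w (R_t (seamB y))‖` for `t ∈ [0, 1]`.  Then
`pageDet (bdDeriv (R_1 ∘ seamB) y) = κ · pageDet (bdDeriv (S^m_1 ∘ seamB) y)` with `κ > 0`.
[cite: Baykur2006, Thm. 5.1 (proof, p. 13)] -/
theorem pageDet_seam_compare (R : AmbientIsotopy (𝓡∂ 4) (Base g))
    (hρR : ∀ (t : ℝ) (x : Base g), rho g (R.toFun t x).1 = rho g x.1)
    (hdirR : ∀ (t : ℝ) (x : Base g), ∃ r : ℝ, 0 < r ∧ w g (R.toFun t x).1 = (r : ℂ) * w g x.1)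
    {m : ℝ} (hm : 0 < m) {y : (bBase g).carrier} (hy : (y.1 : Base g) ∈ coresComplement h)
    {c : ℂ} (hc : ‖c‖ = 1) (hyc : y.1 ∈ page g c) (hR1 : R.toFun 1 (seamB D bX Ψ y) ∈ page g c)
    (hmle : ∀ t ∈ Icc (0 : ℝ) 1, m ≤ ‖w g (R.toFun t (seamB D bX Ψ y)).1‖) :
    ∃ κ : ℝ, 0 < κ ∧ pageDet g (bdDeriv g (R.toFun 1 ∘ seamB D bX Ψ) y) y.1.1 =
      κ * pageDet g (bdDeriv g ((strIso g m hm).toFun 1 ∘ seamB D bX Ψ) y) y.1.1 := by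
  set S := strIso g m hm with hS
  set p₀ := seamB D bX Ψ y with hp₀
  set q := S.toFun 1 p₀ with hq
  set q' := R.toFun 1 p₀ with hq'
  have hSd : ∀ (t : ℝ) (x : Base g), MDifferentiableAt (𝓡∂ 4) (𝓡∂ 4) (S.toFun t) x := fun t x =>
    (S.contMDiff_toFun t).mdifferentiableAt (by simp)
  have hRd : ∀ (t : ℝ) (x : Base g), MDifferentiableAt (𝓡∂ 4) (𝓡∂ 4) (R.toFun t) x := fun t x =>
    (R.contMDiff_toFun t).mdifferentiableAt (by simp)
  have hsB : MDifferentiableAt (𝓡 3) (𝓡∂ 4) (seamB D bX Ψ) y :=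
    (contMDiffAt_seamB D bX Ψ hy).mdifferentiableAt (by simp)
  -- the orbit `R_t p₀` is flattened by `S_1`
  have hS1 : ∀ t ∈ Icc (0 : ℝ) 1, S.toFun 1 (R.toFun t p₀) ∈ page g c := by
    intro t ht
    refine str_flat m hm _ c hc (by rw [hρR, rho_seamB]) (hmle t ht) ?_
    obtain ⟨r₁, hr₁, h₁⟩ := w_seamB_dir D bX Ψ hpage hy hyc
    obtain ⟨r₂, hr₂, h₂⟩ := hdirR t p₀
    exact ⟨r₂ * r₁, mul_pos hr₂ hr₁, by rw [h₂, h₁]; push_cast; ring⟩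
  -- the factorisation `bdDeriv (R_1 ∘ seamB) = ambDeriv (R_1 ∘ S_{-1}) q ∘ bdDeriv (S_1 ∘ seamB)`
  have hR1fac : (R.toFun 1 : Base g → Base g) = (R.toFun 1 ∘ S.toFun (-1)) ∘ S.toFun 1 := by
    funext x
    show R.toFun 1 x = R.toFun 1 (S.toFun (-1) (S.toFun 1 x))
    rw [str_left_inv m hm x]
  have hq0 : S.toFun (-1) q = p₀ := str_left_inv m hm p₀
  have hfac : bdDeriv g (R.toFun 1 ∘ seamB D bX Ψ) y =
      (ambDeriv g (R.toFun 1 ∘ S.toFun (-1)) q).comp (bdDeriv g (S.toFun 1 ∘ seamB D bX Ψ) y) := by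
    rw [bdDeriv_comp (hRd 1 _) hsB, bdDeriv_comp (hSd 1 _) hsB, ← ContinuousLinearMap.comp_assoc]
    congr 1
    have h1 : ambDeriv g (R.toFun 1) p₀ = ambDeriv g ((R.toFun 1 ∘ S.toFun (-1)) ∘ S.toFun 1) p₀ := by
      rw [← hR1fac]
    have hmd : MDifferentiableAt (𝓡∂ 4) (𝓡∂ 4) (R.toFun 1 ∘ S.toFun (-1)) (S.toFun 1 p₀) :=
      (hRd 1 _).comp _ (hSd (-1) _)
    rw [h1, ambDeriv_comp hmd (hSd 1 p₀)]
  -- multiplicativity of the page determinant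
  have hline := bdDeriv_comp_seamB_line D bX Ψ hpage (S.contMDiff_toFun 1) (str_rho_base m hm 1)
    (str_dir_base m hm 1) hy hc hyc (str_seamB_mem_page D bX Ψ hpage hm hy hc hyc
      ((hmle 0 ⟨le_rfl, zero_le_one⟩).trans (by rw [R.map_zero]; rfl)))
  have hmult := pageDet_comp (bdDeriv g (S.toFun 1 ∘ seamB D bX Ψ) y)
    (ambDeriv g (R.toFun 1 ∘ S.toFun (-1)) q) (coe_ne_zero q) (hline _ (dPhi_pageVec _))
    (hline _ (dPhi_cplxJ_pageVec _))
  rw [← hfac] at hmult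
  -- positivity of the middle factor
  have hpos : 0 < pageDet g (ambDeriv g (R.toFun 1 ∘ S.toFun (-1)) q) q.1 :=
    helper_pageDet_straighten_pos g R S (strFlow g m hm) (str_contDiff m hm) (str_zero m hm) (str_add m hm)
      (str_coe m hm) (str_rho m hm) (str_dir m hm) (str_page_fwd m hm) hρR hdirR p₀ c hc hS1 hR1
  have hτ : 0 < ‖pageVec g q.1‖ ^ 2 := by
    have := pageVec_ne_zero (g := g) (coe_ne_zero q); positivity
  refine ⟨pageDet g (ambDeriv g (R.toFun 1 ∘ S.toFun (-1)) q) q.1 / ‖pageVec g q.1‖ ^ 2, by positivity, ?_⟩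
  rw [div_mul_eq_mul_div, eq_div_iff hτ.ne', hmult]
  ring

include hpage in
/-- **Two universal straightenings induce positively proportional page determinants**: for
`0 < m, m' ≤ ‖w (seamB y)‖`. [cite: Baykur2006, Thm. 5.1 (proof, p. 13)] -/
theorem pageDet_seam_compare_str {m m' : ℝ} (hm : 0 < m) (hm' : 0 < m') {y : (bBase g).carrier}
    (hy : (y.1 : Base g) ∈ coresComplement h) {c : ℂ} (hc : ‖c‖ = 1) (hyc : y.1 ∈ page g c)
    (hmw : m ≤ ‖w g (seamB D bX Ψ y).1‖) (hm'w : m' ≤ ‖w g (seamB D bX Ψ y).1‖) :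
    ∃ κ : ℝ, 0 < κ ∧ pageDet g (bdDeriv g ((strIso g m' hm').toFun 1 ∘ seamB D bX Ψ) y) y.1.1 =
      κ * pageDet g (bdDeriv g ((strIso g m hm).toFun 1 ∘ seamB D bX Ψ) y) y.1.1 := by
  refine pageDet_seam_compare D bX Ψ hpage (strIso g m' hm') (str_rho_base m' hm') (str_dir_base m' hm')
    hm hy hc hyc (str_seamB_mem_page D bX Ψ hpage hm' hy hc hyc hm'w) fun t ht => ?_
  rw [str_coe]
  exact hmw.trans (str_norm_w_mono m' hm' t _ ht.1)

include hpage in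
/-- **The page determinant of a universal straightening of the seam map does not vanish** at a flat page
point off the cores with `m ≤ ‖w (seamB y)‖`. [cite: EtnyreFuller2006, Thm. 1 (proof, p. 8)] -/
theorem pageDet_seam_str_ne_zero {m : ℝ} (hm : 0 < m) {y : (bBase g).carrier}
    (hy : (y.1 : Base g) ∈ coresComplement h) {c : ℂ} (hc : ‖c‖ = 1) (hyc : y.1 ∈ page g c)
    (hmw : m ≤ ‖w g (seamB D bX Ψ y).1‖) :
    pageDet g (bdDeriv g ((strIso g m hm).toFun 1 ∘ seamB D bX Ψ) y) y.1.1 ≠ 0 := by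
  set S := strIso g m hm with hS
  have hsB : MDifferentiableAt (𝓡 3) (𝓡∂ 4) (seamB D bX Ψ) y :=
    (contMDiffAt_seamB D bX Ψ hy).mdifferentiableAt (by simp)
  have hG : MDifferentiableAt (𝓡 3) (𝓡∂ 4) (S.toFun 1 ∘ seamB D bX Ψ) y :=
    ((S.contMDiff_toFun 1).mdifferentiableAt (by simp)).comp y hsB
  have hline := bdDeriv_comp_seamB_line D bX Ψ hpage (S.contMDiff_toFun 1) (str_rho_base m hm 1)
    (str_dir_base m hm 1) hy hc hyc (str_seamB_mem_page D bX Ψ hpage hm hy hc hyc hmw)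
  have hinj : Injective (mfderiv (𝓡 3) (𝓡∂ 4) (S.toFun 1 ∘ seamB D bX Ψ) y) := by
    rw [mfderiv_comp y ((S.contMDiff_toFun 1).mdifferentiableAt (by simp)) hsB]
    exact ((S.isLocalDiffeomorph 1 _).mfderivToContinuousLinearEquiv (by simp)).injective.comp
      (injective_mfderiv_seamB D bX Ψ hy)
  obtain ⟨hflat, -⟩ := flat_of_mem_page hc hyc
  refine pageDet_ne_zero _ (coe_ne_zero y.1) (coe_ne_zero _) (fun X hX hX0 => ?_)
    (hline _ (dPhi_pageVec _)) (hline _ (dPhi_cplxJ_pageVec _))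
  have hρX : fderiv ℝ (rho g) y.1.1 X = 0 := by
    rw [fderiv_rho_apply_of_flat hflat, hX, mul_zero, Complex.zero_re, mul_zero]
  exact bdDeriv_eq_zero_imp hG hinj hρX hX0

end Compare

/-- **Sub-goal `helper_pageDet_seam_compare` of stub `stub_T3_dualPresentation`** (T3 ▸ T3c-2 ▸ ST4
`node_ST4_twistSign`, brick X3-5a; wave 5, lead c5): **the knot's flattening and the universal
straightening of the seam map have positively proportional page determinants.**  For the data
`(D, bX, Ψ)` with the page clause, a flat page point `y ∈ page g c` off the cores, a fibred ambient
isotopy `R` with `R_1 (seamB y) ∈ page g c`, and `0 < m ≤ ‖w (R_t (seamB y))‖` on `[0, 1]`: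
`pageDet (bdDeriv (R_1 ∘ seamB) y) = κ · pageDet (bdDeriv (S^m_1 ∘ seamB) y)`, `κ > 0`, where
`S^m = strIso g m` is the straightening isotopy of ST2. [cite: Baykur2006, Thm. 5.1 (proof, p. 13)] -/
theorem helper_pageDet_seam_compare : ∀ (g : ℕ) (ι : Type) [Finite ι] (h : ι → Literature.Topology.FourManifolds.HandleAttachingMap 3 2 (Literature.Topology.FourManifolds.LefschetzBase.Base g)) (X : Type) [TopologicalSpace X] [ChartedSpace (EuclideanHalfSpace 4) X] [IsManifold (𝓡∂ 4) ∞ X] (D : Literature.Topology.FourManifolds.HandleAttachingMap.MultiAttachmentData h (𝓡∂ 4) X) (bX : Literature.Topology.FourManifolds.BoundaryData (𝓡∂ 4) X (𝓡 3)) [Nonempty bX.carrier] (Ψ : bX.carrier ≃ₘ⟮𝓡 3, 𝓡 3⟯ (Literature.Topology.FourManifolds.LefschetzBase.bBase g).carrier), (∀ (y : bX.carrier) (a : ↥(Literature.Topology.FourManifolds.HandleAttachingMap.coresComplement h)), bX.incl y = D.jA a → ∃ c : ℝ, 0 < c ∧ Literature.Topology.FourManifolds.LefschetzBase.w g ((Literature.Topology.FourManifolds.LefschetzBase.bBase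 g).incl (Ψ y)).1 = (c : ℂ) * Literature.Topology.FourManifolds.LefschetzBase.w g (a : Literature.Topology.FourManifolds.LefschetzBase.Base g).1) → ∀ (R : Literature.Topology.FourManifolds.AmbientIsotopy (𝓡∂ 4) (Literature.Topology.FourManifolds.LefschetzBase.Base g)), (∀ (t : ℝ) (x : Literature.Topology.FourManifolds.LefschetzBase.Base g), Literature.Topology.FourManifolds.LefschetzBase.rho g (R.toFun t x).1 = Literature.Topology.FourManifolds.LefschetzBase.rho g x.1) → (∀ (t : ℝ) (x : Literature.Topology.FourManifolds.LefschetzBase.Base g), ∃ r : ℝ, 0 < r ∧ Literature.Topology.FourManifolds.LefschetzBase.w g (R.toFun t x).1 = (r : ℂ) * Literature.Topology.FourManifolds.LefschetzBase.w g x.1) → ∀ (m : ℝ) (hm : 0 < m) (y : (Literature.Topology.FourManifolds.LefschetzBase.bBase g).carrier), (y.1 : Literature.Topology.FourManifolds.LefschetzBase.Base g) ∈ Literature.Topology.FourManifolds.HandleAttachingMap.coresComplement h → ∀ (c : ℂ), ‖c‖ = 1 → y.1 ∈ Literature.Topology.FourManifolds.LefschetzBase.page g c → R.toFun 1 (Summit.SmoothPoincare4.SmoothPoincare4.Theorems.AcyclicBisectionExists.ModpBraidOrbits.seamB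 D bX Ψ y) ∈ Literature.Topology.FourManifolds.LefschetzBase.page g c → (∀ t ∈ Set.Icc (0 : ℝ) 1, m ≤ ‖Literature.Topology.FourManifolds.LefschetzBase.w g (R.toFun t (Summit.SmoothPoincare4.SmoothPoincare4.Theorems.AcyclicBisectionExists.ModpBraidOrbits.seamB D bX Ψ y)).1‖) → ∃ κ : ℝ, 0 < κ ∧ Summit.SmoothPoincare4.SmoothPoincare4.Theorems.AcyclicBisectionExists.ModpBraidOrbits.pageDet g (Summit.SmoothPoincare4.SmoothPoincare4.Theorems.AcyclicBisectionExists.ModpBraidOrbits.bdDeriv g (R.toFun 1 ∘ Summit.SmoothPoincare4.SmoothPoincare4.Theorems.AcyclicBisectionExists.ModpBraidOrbits.seamB D bX Ψ) y) y.1.1 = κ * Summit.SmoothPoincare4.SmoothPoincare4.Theorems.AcyclicBisectionExists.ModpBraidOrbits.pageDet g (Summit.SmoothPoincare4.SmoothPoincare4.Theorems.AcyclicBisectionExists.ModpBraidOrbits.bdDeriv g ((Summit.SmoothPoincare4.SmoothPoincare4.Theorems.AcyclicBisectionExists.ModpBraidOrbits.strIso g m hm).toFun 1 ∘ Summit.SmoothPoincare4.SmoothPoincare4.Theorems.AcyclicBisectionExists.ModpBraidOrbits.seamB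 D bX Ψ) y) y.1.1 :=
  fun _ _ _ _ _ _ _ _ D bX _ Ψ hpage R hρR hdirR _ hm _ hy _ hc hyc hR1 hmle =>
    pageDet_seam_compare D bX Ψ hpage R hρR hdirR hm hy hc hyc hR1 hmle

end Summit.SmoothPoincare4.SmoothPoincare4.Theorems.AcyclicBisectionExists.ModpBraidOrbits

end
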